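import Summits.SmoothPoincare4.SmoothPoincare4.Theorems.ConvexBisectionAcyclicBisectionExistsPageRotationFlow
import HarnessLib

/-!
# The in-page tube field of the Lefschetz base and its flow
(wave 3, worker Z4, brick T3c-1 (3b) "page-adapted circle tube", part 1, of stub
`stub_steinRealisation` = NF6 `Literature.Geometry.Symplectic.steinRealisation_of_sorted_modelsOnFibred`,
line `modp-braid-orbits` r11, crux `ConvexBisection.AcyclicBisectionExists`, item
stmt-SmoothPoincare4-10508; registered sub-goal `helper_pageField_flow`)

Node T3c-1 compares, in the boundary 3-manifold `∂ Base g` of the Lefschetz base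
`Base g = {rho g ≤ 1/4} ⊂ ℂ²`, the boundary tube of a 2-handle attached along a page curve `K` with a
tube ADAPTED TO THE PAGES (Kosinski, *Differential Manifolds* (1993), III (3.1): uniqueness of
tubular neighbourhoods of a circle, tree file `CircleTubeUniqueness.lean`).  The page-adapted tube is
`(ψ, (a, b)) ↦ R_b (P_a ψ)` with `R` the page-rotation flow (`…PageRotationFlow.lean`) and `P_a` a
tubular neighbourhood of `K` INSIDE its page; this file builds the generator of `P`:

* §1 two cut-offs `flatCut δ` (`1` over `‖x‖² ≤ 4 − δ`, `0` over `‖x‖² ≥ 4 − δ/2`) and `parCut`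
  (`1` on `‖m‖ ≤ 1`, `0` on `‖m‖² ≥ 2`);
* §2 the PARAMETRISED IN-PAGE FIELD `pageFieldP g δ` on `ℝ⁴ × ℂ`: at `(q, m)` it is
  `(χ(q, m) · m ⋆ s(q), 0)` with `s(q) = (∂Φ/∂y, −∂Φ/∂x)(q)` the vector spanning the complex tangent
  line `ker dΦ_q` of the page through `q` over `ℂ` (`kerVec`), `m ∈ ℂ` a parameter carried along
  unchanged (second component `0`), and `χ = cutA(rho) · flatCut δ (‖x‖²) · parCut m`; it is smooth,
  compactly supported, and its `ℝ⁴`-component lies in `ker dw ∩ ker d rho` (`fderiv_w_pageFieldP`,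
  `fderiv_rho_pageFieldP`: `dΦ(m ⋆ s) = 0`, and the `eta`-term of `d rho` vanishes because the field
  is cut off before the rim `‖x‖² = 4` of the flat part);
* §3 its complete flow `Θ` (the tree's `Literature.Geometry.Manifold.exists_contDiff_globalFlow`,
  Lee 2012 Thm. 9.16) and the invariants along flow lines: the parameter `m`, `rho` and `w` are
  constant — so `a ↦ Θ (a, (q, m))` moves `q` inside its page `{rho = 1/4, w = c/2}`;
* §4 the registered package `helper_pageField_flow`.

The parameter `m` is what makes ONE flow serve every direction: along an embedded page curve the
in-page normal `i K'` is `m(ψ) ⋆ s(K ψ)` for a smooth `m : 𝕊¹ → ℂ` (sequel, part 2), and the flow of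
the field on the product `ℝ⁴ × ℂ` started at `(K ψ, m ψ)` is jointly smooth in `(a, ψ)`.
Everything is proved; no named facts, no `sorry`.  References: A. A. Kosinski, *Differential
Manifolds* (1993), III (3.1) [Kosinski1993]; J. M. Lee, *Introduction to Smooth Manifolds* (2012),
Thm. 9.16 [LeeSmoothManifolds2013]; R. İ. Baykur, *Kähler decomposition of 4-manifolds*, AGT 6
(2006), proof of Thm. 5.1 [Baykur2006].
-/

noncomputable section

set_option linter.dupNamespace false

open scoped Manifold ContDiff Topology ComplexConjugate
open Set Function Metric
open Literature.Topology.FourManifolds Literature.Topology.FourManifolds.LefschetzBase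

namespace Summit.SmoothPoincare4.SmoothPoincare4.Theorems.AcyclicBisectionExists.ModpBraidOrbits

variable {g : ℕ} {δ : ℝ}

/-! ## §1 Two cut-offs -/

/-- The flat-part cut-off `flatCut δ s = smoothTransition ((8 − δ − 2s)/δ)`: `1` for `s ≤ 4 − δ`,
`0` for `s ≥ 4 − δ/2` (applied to `s = ‖x‖²`). [folklore] -/
def flatCut (δ s : ℝ) : ℝ := Real.smoothTransition ((8 - δ - 2 * s) / δ)

/-- `flatCut δ = 1` on `s ≤ 4 − δ`. [folklore] -/
theorem flatCut_of_le (hδ : 0 < δ) {s : ℝ} (h : s ≤ 4 - δ) : flatCut δ s = 1 :=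
  Real.smoothTransition.one_of_one_le (by rw [le_div_iff₀ hδ]; linarith)

/-- `flatCut δ = 0` on `s ≥ 4 − δ/2`. [folklore] -/
theorem flatCut_of_ge (hδ : 0 < δ) {s : ℝ} (h : 4 - δ / 2 ≤ s) : flatCut δ s = 0 :=
  Real.smoothTransition.zero_of_nonpos (div_nonpos_of_nonpos_of_nonneg (by linarith) hδ.le)

/-- `flatCut δ` is smooth. [folklore] -/
theorem contDiff_flatCut (δ : ℝ) : ContDiff ℝ ∞ (flatCut δ) :=
  Real.smoothTransition.contDiff.comp
    ((contDiff_const.sub (contDiff_const.mul contDiff_id)).div_const _)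

/-- The parameter cut-off `parCut m = smoothTransition (2 − ‖m‖²)`: `1` for `‖m‖ ≤ 1`, `0` for
`‖m‖² ≥ 2`. [folklore] -/
def parCut (m : ℂ) : ℝ := Real.smoothTransition (2 - ‖m‖ ^ 2)

/-- `parCut = 1` on the closed unit disc. [folklore] -/
theorem parCut_of_le {m : ℂ} (h : ‖m‖ ≤ 1) : parCut m = 1 :=
  Real.smoothTransition.one_of_one_le (by nlinarith [norm_nonneg m])

/-- `parCut = 0` on `‖m‖² ≥ 2`. [folklore] -/
theorem parCut_of_ge {m : ℂ} (h : 2 ≤ ‖m‖ ^ 2) : parCut m = 0 :=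
  Real.smoothTransition.zero_of_nonpos (by linarith)

/-- `parCut` is smooth. [folklore] -/
theorem contDiff_parCut : ContDiff ℝ ∞ parCut :=
  Real.smoothTransition.contDiff.comp (contDiff_const.sub contDiff_norm_sq_complex)

/-! ## §2 The parametrised in-page field on `ℝ⁴ × ℂ` -/

/-- The in-page vector `m ⋆ s(q) = (m ∂Φ/∂y, −m ∂Φ/∂x)`: the complex multiples of
`s = (∂Φ/∂y, −∂Φ/∂x)`, which spans `ker dΦ_q` over `ℂ`. [folklore] -/
def kerVec (g : ℕ) (q : EuclideanSpace ℝ (Fin 4)) (m : ℂ) : EuclideanSpace ℝ (Fin 4) :=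
  mk (m * dPhiY q) (-(m * dPhiX g q))

/-- The total cut-off `cutA (rho q) · flatCut δ ‖x(q)‖² · parCut m`. [folklore] -/
def tubeCut (g : ℕ) (δ : ℝ) (z : EuclideanSpace ℝ (Fin 4) × ℂ) : ℝ :=
  cutA (rho g z.1) * flatCut δ (‖cx z.1‖ ^ 2) * parCut z.2

/-- **The parametrised in-page field** on `ℝ⁴ × ℂ`: `(q, m) ↦ (χ(q, m) · m ⋆ s(q), 0)`.
[folklore] -/
def pageFieldP (g : ℕ) (δ : ℝ) (z : EuclideanSpace ℝ (Fin 4) × ℂ) : EuclideanSpace ℝ (Fin 4) × ℂ :=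
  (tubeCut g δ z • kerVec g z.1 z.2, 0)

/-- `cx (m ⋆ s) = m ∂Φ/∂y`. [folklore] -/
@[simp] theorem cx_kerVec (q : EuclideanSpace ℝ (Fin 4)) (m : ℂ) :
    cx (kerVec g q m) = m * dPhiY q := cx_mk _ _

/-- `cy (m ⋆ s) = −m ∂Φ/∂x`. [folklore] -/
@[simp] theorem cy_kerVec (q : EuclideanSpace ℝ (Fin 4)) (m : ℂ) :
    cy (kerVec g q m) = -(m * dPhiX g q) := cy_mk _ _

/-- `m ⋆ s(q) ∈ ker dΦ_q`. [folklore] -/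
theorem dPhi_kerVec (q : EuclideanSpace ℝ (Fin 4)) (m : ℂ) :
    dPhiX g q * cx (kerVec g q m) + dPhiY q * cy (kerVec g q m) = 0 := by
  rw [cx_kerVec, cy_kerVec]; ring

/-- The parameter component of the field vanishes. [folklore] -/
@[simp] theorem pageFieldP_snd (z : EuclideanSpace ℝ (Fin 4) × ℂ) : (pageFieldP g δ z).2 = 0 := rfl

/-- The `ℝ⁴`-component of the field. [folklore] -/
theorem pageFieldP_fst (z : EuclideanSpace ℝ (Fin 4) × ℂ) :
    (pageFieldP g δ z).1 = tubeCut g δ z • kerVec g z.1 z.2 := rfl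

/-- The `ℝ⁴`-component of the field lies in `ker dΦ`. [folklore] -/
theorem dPhi_pageFieldP (z : EuclideanSpace ℝ (Fin 4) × ℂ) :
    dPhiX g z.1 * cx (pageFieldP g δ z).1 + dPhiY z.1 * cy (pageFieldP g δ z).1 = 0 := by
  rw [pageFieldP_fst, cx_smul, cy_smul, cx_kerVec, cy_kerVec]; ring

/-- **`dw` kills the field.** [folklore] -/
theorem fderiv_w_pageFieldP (z : EuclideanSpace ℝ (Fin 4) × ℂ) :
    fderiv ℝ (w g) z.1 (pageFieldP g δ z).1 = 0 := by
  rw [fderiv_w_apply, dPhi_pageFieldP]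

/-- Over `‖x‖² ≥ 4 − δ/2` the field vanishes. [folklore] -/
theorem pageFieldP_fst_eq_zero_of_ge (hδ : 0 < δ) {z : EuclideanSpace ℝ (Fin 4) × ℂ}
    (h : 4 - δ / 2 ≤ ‖cx z.1‖ ^ 2) : (pageFieldP g δ z).1 = 0 := by
  rw [pageFieldP_fst, tubeCut, flatCut_of_ge hδ h, mul_zero, zero_mul, zero_smul]

/-- **`d rho` kills the field**: the `w`-term because `dw` does, the `eta`-term because
`eta' = 0` over the flat part `‖x‖² < 4` while the field vanishes from `‖x‖² = 4 − δ/2` on.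
[folklore] -/
theorem fderiv_rho_pageFieldP (hδ : 0 < δ) (z : EuclideanSpace ℝ (Fin 4) × ℂ) :
    fderiv ℝ (rho g) z.1 (pageFieldP g δ z).1 = 0 := by
  rw [fderiv_rho_apply, fderiv_w_pageFieldP, mul_zero, Complex.zero_re, mul_zero, zero_add]
  by_cases hx : ‖cx z.1‖ ^ 2 < 4
  · rw [(hasDerivAt_eta_of_lt hx).deriv, zero_mul]
  · rw [pageFieldP_fst_eq_zero_of_ge hδ (by linarith [not_lt.1 hx]), cx_zero, mul_zero,
      Complex.zero_re, mul_zero, mul_zero]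

/-- The total cut-off is smooth. [folklore] -/
theorem contDiff_tubeCut (g : ℕ) (δ : ℝ) : ContDiff ℝ ∞ (tubeCut g δ) :=
  ((contDiff_cutA.comp ((contDiff_rho g).comp contDiff_fst)).mul
    ((contDiff_flatCut δ).comp ((contDiff_norm_sq_complex.comp contDiff_cx).comp contDiff_fst))).mul
    (contDiff_parCut.comp contDiff_snd)

/-- `(q, m) ↦ m ⋆ s(q)` is smooth. [folklore] -/
theorem contDiff_kerVec (g : ℕ) :
    ContDiff ℝ ∞ fun z : EuclideanSpace ℝ (Fin 4) × ℂ => kerVec g z.1 z.2 :=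
  contDiff_mk₂.comp ((contDiff_snd.mul (contDiff_dPhiY.comp contDiff_fst)).prodMk
    (contDiff_snd.mul ((contDiff_dPhiX g).comp contDiff_fst)).neg)

/-- **The parametrised field is smooth.** [folklore] -/
theorem contDiff_pageFieldP (g : ℕ) (δ : ℝ) : ContDiff ℝ ∞ (pageFieldP g δ) :=
  ((contDiff_tubeCut g δ).smul (contDiff_kerVec g)).prodMk contDiff_const

/-- **The parametrised field is supported in the compact set `{rho ≤ 2/5} × {‖m‖ ≤ 2}`.**
[folklore] -/
theorem pageFieldP_eq_zero_of_not_mem {z : EuclideanSpace ℝ (Fin 4) × ℂ}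
    (hz : z ∉ (rho g ⁻¹' Iic (2 / 5) : Set (EuclideanSpace ℝ (Fin 4))) ×ˢ closedBall (0 : ℂ) 2) :
    pageFieldP g δ z = 0 := by
  rw [mem_prod, not_and_or] at hz
  have h0 : tubeCut g δ z = 0 := by
    rcases hz with h | h
    · rw [mem_preimage, mem_Iic, not_le] at h
      rw [tubeCut, cutA_of_ge h.le, zero_mul, zero_mul]
    · rw [mem_closedBall_zero_iff, not_le] at h
      rw [tubeCut, parCut_of_ge (by nlinarith [norm_nonneg z.2]), mul_zero]
  rw [pageFieldP, h0, zero_smul, Prod.mk_zero_zero]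

/-- The support bound is compact. [folklore] -/
theorem isCompact_pageFieldP_support (g : ℕ) :
    IsCompact ((rho g ⁻¹' Iic (2 / 5) : Set (EuclideanSpace ℝ (Fin 4))) ×ˢ closedBall (0 : ℂ) 2) :=
  (isCompact_rho_le_two_fifths g).prod (isCompact_closedBall _ _)

/-! ## §3 The flow of the parametrised field and its invariants -/

/-- **The parametrised in-page field has a smooth complete flow** on `ℝ⁴ × ℂ` (compact support;
Lee 2012, Thm. 9.16). [cite: LeeSmoothManifolds2013, Thm. 9.16] -/
theorem exists_pageFlow (g : ℕ) (δ : ℝ) :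
    ∃ Θ : ℝ × (EuclideanSpace ℝ (Fin 4) × ℂ) → EuclideanSpace ℝ (Fin 4) × ℂ, ContDiff ℝ ∞ Θ ∧
      (∀ z, Θ (0, z) = z) ∧ (∀ t s z, Θ (t, Θ (s, z)) = Θ (t + s, z)) ∧
      ∀ z t, HasDerivAt (fun t => Θ (t, z)) (pageFieldP g δ (Θ (t, z))) t := by
  obtain ⟨Θ, hΘ, h0, hadd, hder, -⟩ := Literature.Geometry.Manifold.exists_contDiff_globalFlow
    (contDiff_pageFieldP g δ) (isCompact_pageFieldP_support g)
    (fun z hz => pageFieldP_eq_zero_of_not_mem hz)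
  exact ⟨Θ, hΘ, h0, hadd, hder⟩

section Curve

variable {γ : ℝ → EuclideanSpace ℝ (Fin 4) × ℂ} (hγ : ∀ t, HasDerivAt γ (pageFieldP g δ (γ t)) t)
include hγ

/-- The parameter does not move along integral curves. [folklore] -/
theorem hasDerivAt_snd_pageFlowline (t : ℝ) : HasDerivAt (fun s => (γ s).2) 0 t := by
  have h := (ContinuousLinearMap.snd ℝ (EuclideanSpace ℝ (Fin 4)) ℂ).hasFDerivAt.comp_hasDerivAt t
    (hγ t)
  exact h

/-- **The parameter is a first integral.** [folklore] -/
theorem snd_pageFlowline_eq (t : ℝ) : (γ t).2 = (γ 0).2 :=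
  is_const_of_deriv_eq_zero (fun s => (hasDerivAt_snd_pageFlowline hγ s).differentiableAt)
    (fun s => (hasDerivAt_snd_pageFlowline hγ s).deriv) t 0

/-- The `ℝ⁴`-component of an integral curve. [folklore] -/
theorem hasDerivAt_fst_pageFlowline (t : ℝ) :
    HasDerivAt (fun s => (γ s).1) (pageFieldP g δ (γ t)).1 t :=
  (ContinuousLinearMap.fst ℝ (EuclideanSpace ℝ (Fin 4)) ℂ).hasFDerivAt.comp_hasDerivAt t (hγ t)

/-- `w` does not move along integral curves. [folklore] -/
theorem hasDerivAt_w_pageFlowline (t : ℝ) : HasDerivAt (fun s => w g (γ s).1) 0 t := by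
  have h := (((contDiff_w g).differentiable (by simp)) (γ t).1).hasFDerivAt.comp_hasDerivAt t
    (hasDerivAt_fst_pageFlowline hγ t)
  rwa [fderiv_w_pageFieldP] at h

/-- **`w` is a first integral**: the flow maps every page `{w = c/2}` into itself. [folklore] -/
theorem w_pageFlowline_eq (t : ℝ) : w g (γ t).1 = w g (γ 0).1 :=
  is_const_of_deriv_eq_zero (fun s => (hasDerivAt_w_pageFlowline hγ s).differentiableAt)
    (fun s => (hasDerivAt_w_pageFlowline hγ s).deriv) t 0

/-- `rho` does not move along integral curves. [folklore] -/
theorem hasDerivAt_rho_pageFlowline (hδ : 0 < δ) (t : ℝ) :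
    HasDerivAt (fun s => rho g (γ s).1) 0 t := by
  have h := (((contDiff_rho g).differentiable (by simp)) (γ t).1).hasFDerivAt.comp_hasDerivAt t
    (hasDerivAt_fst_pageFlowline hγ t)
  rwa [fderiv_rho_pageFieldP hδ] at h

/-- **`rho` is a first integral**: the flow preserves the base and its boundary. [folklore] -/
theorem rho_pageFlowline_eq (hδ : 0 < δ) (t : ℝ) : rho g (γ t).1 = rho g (γ 0).1 :=
  is_const_of_deriv_eq_zero (fun s => (hasDerivAt_rho_pageFlowline hγ hδ s).differentiableAt)
    (fun s => (hasDerivAt_rho_pageFlowline hγ hδ s).deriv) t 0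

end Curve

/-! ## §4 The registered sub-goal: the in-page flow -/

/-- **The in-page tube flow of the Lefschetz base** (registered sub-goal `helper_pageField_flow` of
NF6, brick T3c-1 (3b)): for every width `δ > 0` there is a smooth complete flow `Θ` on `ℝ⁴ × ℂ`
whose flow lines are the integral curves of the parametrised in-page field
`(q, m) ↦ (cutA (rho q) · flatCut δ ‖x‖² · parCut m) · (m ∂Φ/∂y, −m ∂Φ/∂x), 0)`, and along which
the parameter `m`, the defining function `rho` of the base and the page coordinate `w` are
constant: for every unit `c`, the stage `a ↦ (Θ (a, (q, m))).1` moves a point `q` of the page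
`{rho = 1/4, w = c/2}` inside that page — the one-parameter groups from which the page-adapted
tubular neighbourhood of a page curve is assembled (Kosinski 1993, III (3.1)).
[cite: Kosinski1993, III (3.1)] -/
theorem helper_pageField_flow : ∀ (g : ℕ) (δ : ℝ), 0 < δ →
    ∃ Θ : ℝ × (EuclideanSpace ℝ (Fin 4) × ℂ) → EuclideanSpace ℝ (Fin 4) × ℂ, ContDiff ℝ ∞ Θ ∧
      (∀ z, Θ (0, z) = z) ∧ (∀ t s z, Θ (t, Θ (s, z)) = Θ (t + s, z)) ∧
      (∀ z t, HasDerivAt (fun t => Θ (t, z))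
        ((Summit.SmoothPoincare4.SmoothPoincare4.Theorems.AcyclicBisectionExists.ModpBraidOrbits.cutA
          (Literature.Topology.FourManifolds.LefschetzBase.rho g (Θ (t, z)).1) *
          Real.smoothTransition ((8 - δ - 2 * ‖Literature.Topology.FourManifolds.LefschetzBase.cx
            (Θ (t, z)).1‖ ^ 2) / δ) * Real.smoothTransition (2 - ‖(Θ (t, z)).2‖ ^ 2)) •
          Literature.Topology.FourManifolds.LefschetzBase.mk
            ((Θ (t, z)).2 * Literature.Topology.FourManifolds.LefschetzBase.dPhiY (Θ (t, z)).1)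
            (-((Θ (t, z)).2 * Literature.Topology.FourManifolds.LefschetzBase.dPhiX g (Θ (t, z)).1)),
          (0 : ℂ)) t) ∧
      (∀ t z, (Θ (t, z)).2 = z.2) ∧
      (∀ t z, Literature.Topology.FourManifolds.LefschetzBase.rho g (Θ (t, z)).1 =
        Literature.Topology.FourManifolds.LefschetzBase.rho g z.1) ∧
      (∀ t z, Literature.Topology.FourManifolds.LefschetzBase.w g (Θ (t, z)).1 =
        Literature.Topology.FourManifolds.LefschetzBase.w g z.1) := by
  intro g δ hδ
  obtain ⟨Θ, hΘ, h0, hadd, hder⟩ := exists_pageFlow g δ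
  refine ⟨Θ, hΘ, h0, hadd, hder, fun t z => ?_, fun t z => ?_, fun t z => ?_⟩
  · have h := snd_pageFlowline_eq (hder z) t
    rwa [h0] at h
  · have h := rho_pageFlowline_eq (hder z) hδ t
    rwa [h0] at h
  · have h := w_pageFlowline_eq (hder z) t
    rwa [h0] at h

end Summit.SmoothPoincare4.SmoothPoincare4.Theorems.AcyclicBisectionExists.ModpBraidOrbits
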